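import Summits.QuantumFields.BalabanUV.Beta.GAN24.DirichletExhaustionCoerDict

/-!
# `BalabanUV.Beta.GAN24.DirichletExhaustionCoerZ` — binder row G-an2-4 / (CONV-C), part P2, PART 17 = skeleton node S3.e: BAŁABAN'S CONSTRAINED
# LOWER BOUND (2.153) ON `ℤ^{d+1}` BY TORUS EXHAUSTION — `γ′₀·‖w‖² ≤ ⟨w, Δᶻ_k w⟩` for every finitely supported bond field `w` on `ℤ^{d+1}` with
# vanishing `Lℤ^{d+1}`-block averages and vanishing tree bonds, `γ′₀ = gamma2153 (d+1) L = (γ₀/12(d+1)²)·L^{−(d+2)}`, UNIFORMLY IN `k`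
# (unit b2b-balaban-gan24-p2, gen 2, v1)

HONEST FRAMING (cell contract, verbatim): «discharging `BetaPertH` makes Bałaban's UV stability UNCONDITIONAL — a real constructive-QFT
result; it is NOT the continuum limit and NOT the Clay problem.»  Skeleton `HOME/b2b-balaban-gan24-p2/gen1/SKELETON-P2.md` node S3.e: the torus
lower bound of pv09-g6 (`B6Cov2156Torus.lowerOnConstrainedT_of_represents` for `represents_deltaPol`, constant `gamma2153`, independent of `k`
and of the periods) is pulled back to `ℤ^{d+1}`: a finitely supported constrained `w` is translated by `t ∈ Lℤ^{d+1}` deep into the torus box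
`pbox (N·L)` (PART 16: off the seam the torus average (2.125) does not wrap, `multP = mult`, and the tree predicates agree, both `Lℤ^{d+1}`-
invariant), the torus matrix of the (1.66) form is the periodisation of `deltaZ` (PART 12) with wrap-around tails `O(e^{−κZ·(NL−1)})` (PART 13),
and `N → ∞`.  [folklore] bookkeeping + the tree's theorems BY NAME; nothing printed is used as a hypothesis; NOT `BetaPertH`, NOT continuum,
NOT Clay.  «not in print; our proof attempt».

ABSOLUTE RULE (cell, verbatim): «No internally-minted statement may enter as a cited fact. Every hypothesis is either kernel-proved in this
package or a verbatim quotation of a PUBLISHED theorem with page reference. The manuscript(s) under audit are NOT citable for their own disputed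
steps — they are the thing under adjudication; programme-internal (2001/route/tribunal) claims are never citable.»

WHAT IS PROVED (0 sorry): **`lower2153_Z`** (S3.e) — for `d ≥ 1`, `L ≥ 1`, every `k`, every `w` vanishing off a finite `R`, on the `IsTreeZ` bonds,
and with `Σ_r mult_c(r)·w_r = 0` for every coarse bond `c`, `c₋ ∈ Lℤ^{d+1}`: `gamma2153 (d+1) L · Σ_r w_r² ≤ Σ_{r,s} w_r·deltaZ L k r s·w_s`.
NOT summit progress.
-/

namespace Summit.QuantumFields.BalabanUV.Beta.GAN24.DirichletExhaustionCoerZ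

open Finset Real
open Literature.MathematicalPhysics.QuantumFieldTheory.Balaban1983to89
open B6BondElimination (mult IsTree)
open B6Lemma24Torus (pbox mem_pbox coarseSites coarseSites_dvd faces mem_faces)
open B6Lemma24PrintedShape (q1)
open B6Cov2156Torus (multP perExt q1_perExt_eq_sum_multP lowerOnConstrainedT_of_represents represents_deltaPol gamma2153 deltaPol
  quad_eq_sum_sum)
open B4Sect5Exhaustion (K)
open Summit.QuantumFields.BalabanUV.Beta.GAN24.DirichletExhaustionDeltaZ (deltaZ kappaZ kappaZ_pos)
open Summit.QuantumFields.BalabanUV.Beta.GAN24.DirichletExhaustionTails (tailConst deltaPol_sub_deltaZ_abs_le)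
open Summit.QuantumFields.BalabanUV.Beta.GAN24.DirichletExhaustionElimZ (IsTreeZ)
open Summit.QuantumFields.BalabanUV.Beta.GAN24.DirichletExhaustionCoerDict

noncomputable section

variable {d : ℕ}

/-! ## §4 (2.153) on `ℤ^{d+1}` (S3.e) -/

/-- **S3.e — BAŁABAN'S (2.153) ON `ℤ^{d+1}`, BY TORUS EXHAUSTION.**  Let `d ≥ 1`, `L ≥ 1`, `k ∈ ℕ`.  For every `w : (ℤ^{d+1} × Fin (d+1)) → ℝ`
vanishing off a finite `R`, vanishing on the tree bonds of the `L`-blocks (`IsTreeZ`), and with vanishing block averages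
`Σ_r mult_c(r)·w_r = 0` for every coarse bond `c`, `c₋ ∈ Lℤ^{d+1}` ((2.153)'s subspace «QB = 0, B(Γ_{y,x}) = 0» read on the infinite unit
lattice): `gamma2153 (d+1) L · Σ_r w_r² ≤ Σ_{r,s} w_r·deltaZ L k r s·w_s` — the constant `(γ₀/12(d+1)²)L^{−(d+2)}` of pv09-g6's torus theorem,
uniformly in `k`. -/
theorem lower2153_Z (hd : 1 ≤ d) (L : ℕ) [NeZero L] (k : ℕ) (R : Finset (K (d + 1) (d + 1))) (w : K (d + 1) (d + 1) → ℝ)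
    (hsupp : ∀ r, r ∉ R → w r = 0) (htree : ∀ r, IsTreeZ L r → w r = 0)
    (havg : ∀ c : (Fin (d + 1) → ℤ) × Fin (d + 1), (∀ i, (L : ℤ) ∣ c.1 i) → ∑ r ∈ R, (mult L c r.1 r.2 : ℝ) * w r = 0) :
    gamma2153 (d + 1) L * ∑ r ∈ R, w r ^ 2 ≤ ∑ r ∈ R, ∑ s ∈ R, w r * deltaZ L k r s * w s := by
  classical
  have hL : 0 < L := Nat.pos_of_ne_zero (NeZero.ne L)
  have hκ := kappaZ_pos d
  obtain ⟨A, hA⟩ := exists_coord_bound R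
  -- the translation `t ∈ Lℤ^{d+1}`
  obtain ⟨t, ht_def⟩ : ∃ t : Fin (d + 1) → ℤ, ∀ i, t i = (L : ℤ) * ((A : ℤ) + 1) := ⟨fun _ => (L : ℤ) * ((A : ℤ) + 1), fun _ => rfl⟩
  have ht : ∀ i, (L : ℤ) ∣ t i := fun i => ⟨(A : ℤ) + 1, ht_def i⟩
  -- the tail constant
  set Cst : ℝ := tailConst d * Real.exp (kappaZ d * (2 * (A : ℝ))) * (∑ r ∈ R, |w r|) ^ 2 with hCst
  have hCst0 : 0 ≤ Cst := by
    rw [hCst]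
    unfold tailConst DirichletExhaustionDeltaZ.c166Z
    have := B5Symbol166Strip.MG_pos (d + 1)
    have := B4Sect5Proof.latticeConst_nonneg (d + 1) (kappaZ_pos d).le
    positivity
  -- THE KEY INEQUALITY ON EVERY LARGE TORUS
  have key : ∀ N : ℕ, 2 * A + 3 ≤ N →
      gamma2153 (d + 1) L * ∑ r ∈ R, w r ^ 2 ≤
        (∑ r ∈ R, ∑ s ∈ R, w r * deltaZ L k r s * w s) + Cst * Real.exp (-(kappaZ d * (((N * L : ℕ) : ℝ) - 1))) := by
    intro N hN
    have hN1 : 1 ≤ N := by omega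
    -- the torus `(N·L)^{d+1}`
    obtain ⟨M, hM⟩ : ∃ M : Fin (d + 1) → ℕ, ∀ i, M i = N * L := ⟨fun _ => N * L, fun _ => rfl⟩
    have hMpos : ∀ i, 0 < M i := fun i => by rw [hM i]; exact Nat.mul_pos (by omega) hL
    haveI : ∀ μ, NeZero (M μ) := fun μ => ⟨(hMpos μ).ne'⟩
    have hLM : ∀ i, L ∣ M i := fun i => by rw [hM i]; exact dvd_mul_left L N
    have hMNL : ∀ i, N * L ≤ M i := fun i => (hM i).ge
    have hNL1 : 1 ≤ N * L := Nat.mul_pos (by omega) hL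
    -- the translated support lies in the box, off the seam
    have hcoord : ∀ r ∈ R, ∀ i, (L : ℤ) ≤ (r.1 + t) i ∧ (r.1 + t) i < (M i : ℤ) := by
      intro r hr i
      have h := hA r hr i
      rw [abs_le] at h
      rw [Pi.add_apply, ht_def i, hM i]
      push_cast
      have hL1 : (1 : ℤ) ≤ L := by exact_mod_cast hL
      have hN' : 2 * (A : ℤ) + 3 ≤ N := by exact_mod_cast hN
      have hA0 : (0 : ℤ) ≤ A := by positivity
      constructor
      · nlinarith
      · nlinarith
    have hbox : ∀ r ∈ R, r.1 + t ∈ pbox M := fun r hr => mem_pbox.2 fun i => by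
      have := hcoord r hr i
      have hL0 : (0 : ℤ) ≤ L := by positivity
      exact ⟨by linarith [this.1], this.2⟩
    -- the box field `B b = w(b₋ − t, ν)`
    obtain ⟨B, hB⟩ : ∃ B : B4.Idx (pbox M) (d + 1) → ℝ, ∀ b, B b = w (((b.1 : Fin (d + 1) → ℤ) - t), b.2) :=
      ⟨_, fun _ => rfl⟩
    have hBsupp : ∀ b : B4.Idx (pbox M) (d + 1), B b ≠ 0 →
        ((((b.1 : Fin (d + 1) → ℤ) - t), b.2) : K (d + 1) (d + 1)) ∈ R := by
      intro b hb
      by_contra h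
      exact hb (by rw [hB]; exact hsupp _ h)
    -- (i) the tree constraints of the torus
    have hT : ∀ p, IsTree L (coarseSites L M) p → B p = 0 := by
      intro p hp
      rw [hB]
      apply htree
      have h1 : IsTreeZ L ((p.1 : Fin (d + 1) → ℤ), p.2) := isTreeZ_of_isTree hp
      have h2 : (((p.1 : Fin (d + 1) → ℤ), p.2) : K (d + 1) (d + 1)) = (((p.1 : Fin (d + 1) → ℤ) - t) + t, p.2) := by
        rw [sub_add_cancel]
      rw [h2, isTreeZ_add_iff hL _ t ht] at h1
      exact h1
    -- (ii) the torus averages vanish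
    have hQ : ∀ c ∈ faces L M, q1 L (perExt M B) c = 0 := by
      intro c hc
      rw [q1_perExt_eq_sum_multP]
      suffices h0 : ∑ b : B4.Idx (pbox M) (d + 1), (multP L M c (b.1 : Fin (d + 1) → ℤ) b.2 : ℝ) * B b = 0 by
        rw [h0, mul_zero]
      have hcL : ∀ i, (L : ℤ) ∣ c.1 i := coarseSites_dvd _ (mem_faces.1 hc)
      have hc'L : ∀ i, (L : ℤ) ∣ ((c.1 - t, c.2) : (Fin (d + 1) → ℤ) × Fin (d + 1)).1 i :=
        fun i => by simp only [Pi.sub_apply]; exact dvd_sub (hcL i) (ht i)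
      calc ∑ b : B4.Idx (pbox M) (d + 1), (multP L M c (b.1 : Fin (d + 1) → ℤ) b.2 : ℝ) * B b
          = ∑ b : B4.Idx (pbox M) (d + 1), (mult L (c.1 - t, c.2) ((b.1 : Fin (d + 1) → ℤ) - t) b.2 : ℝ) *
              w (((b.1 : Fin (d + 1) → ℤ) - t), b.2) := by
            refine Finset.sum_congr rfl fun b _ => ?_
            rw [hB]
            by_cases hb : w (((b.1 : Fin (d + 1) → ℤ) - t), b.2) = 0
            · rw [hb, mul_zero, mul_zero]
            · have hr : ((((b.1 : Fin (d + 1) → ℤ) - t), b.2) : K (d + 1) (d + 1)) ∈ R := by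
                by_contra h
                exact hb (hsupp _ h)
              have hdp : (L : ℤ) - 1 ≤ (b.1 : Fin (d + 1) → ℤ) c.2 := by
                have h1 := (hcoord _ hr c.2).1
                simp only [sub_add_cancel] at h1
                linarith
              rw [multP_eq_mult hLM hc b.1.2 hdp]
              congr 2
              have e := mult_translate L (c.1 - t, c.2) (((b.1 : Fin (d + 1) → ℤ)) - t) t b.2
              simp only [sub_add_cancel, Prod.mk.eta] at e
              exact e
        _ = ∑ r ∈ R, (mult L (c.1 - t, c.2) r.1 r.2 : ℝ) * w r :=
            sum_box_translate t R (fun r => (mult L (c.1 - t, c.2) r.1 r.2 : ℝ) * w r)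
              (fun r hr => by simp only [hsupp r hr, mul_zero]) hbox
        _ = 0 := havg (c.1 - t, c.2) hc'L
    -- (iii) (2.153) on the torus, for the matrix of the (1.66) form
    have hn : 1 ≤ L ^ k := Nat.one_le_pow _ _ hL
    have hd2 : 2 ≤ d + 1 := by omega
    have hlow := lowerOnConstrainedT_of_represents M hd2 hL (L ^ k) hn hLM (represents_deltaPol M (L ^ k)) B hQ hT
    have hlhs : ∑ b : B4.Idx (pbox M) (d + 1), B b ^ 2 = ∑ r ∈ R, w r ^ 2 := by
      simp only [hB]
      exact sum_box_translate t R (fun r => w r ^ 2) (fun r hr => by simp only [hsupp r hr]; ring) hbox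
    rw [hlhs, quad_eq_sum_sum] at hlow
    -- (iv) the main term: the box double sum of `deltaZ` is the `R × R` double sum
    have hmain : ∑ b : B4.Idx (pbox M) (d + 1), ∑ b' : B4.Idx (pbox M) (d + 1),
        B b * B b' * deltaZ L k ((b.1 : Fin (d + 1) → ℤ), b.2) ((b'.1 : Fin (d + 1) → ℤ), b'.2) =
        ∑ r ∈ R, ∑ s ∈ R, w r * deltaZ L k r s * w s := by
      have inner : ∀ b : B4.Idx (pbox M) (d + 1), ∑ b' : B4.Idx (pbox M) (d + 1),
          B b * B b' * deltaZ L k ((b.1 : Fin (d + 1) → ℤ), b.2) ((b'.1 : Fin (d + 1) → ℤ), b'.2) =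
          ∑ s ∈ R, w (((b.1 : Fin (d + 1) → ℤ) - t), b.2) * deltaZ L k (((b.1 : Fin (d + 1) → ℤ) - t), b.2) s * w s := by
        intro b
        rw [← sum_box_translate t R
          (fun s => w (((b.1 : Fin (d + 1) → ℤ) - t), b.2) * deltaZ L k (((b.1 : Fin (d + 1) → ℤ) - t), b.2) s * w s)
          (fun s hs => by simp only [hsupp s hs, mul_zero]) hbox]
        refine Finset.sum_congr rfl fun b' _ => ?_
        rw [hB, hB, deltaZ_translate_sub]
        ring
      rw [Finset.sum_congr rfl fun b _ => inner b]
      exact sum_box_translate t R (fun r => ∑ s ∈ R, w r * deltaZ L k r s * w s)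
        (fun r hr => Finset.sum_eq_zero fun s _ => by simp only [hsupp r hr, zero_mul]) hbox
    -- (v) the wrap-around tail
    have hdist : ∀ b b' : B4.Idx (pbox M) (d + 1), B b ≠ 0 → B b' ≠ 0 →
        dist (b.1 : Fin (d + 1) → ℤ) (b'.1 : Fin (d + 1) → ℤ) ≤ 2 * (A : ℝ) := by
      intro b b' hb hb'
      have hr := hA _ (hBsupp b hb)
      have hs := hA _ (hBsupp b' hb')
      refine (dist_pi_le_iff (by positivity)).2 fun i => ?_
      rw [Int.dist_eq]
      have h1 := hr i
      have h2 := hs i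
      simp only [Pi.sub_apply] at h1 h2
      rw [abs_le] at h1 h2 ⊢
      obtain ⟨h1a, h1b⟩ := h1
      obtain ⟨h2a, h2b⟩ := h2
      have e1 := (Int.cast_le (R := ℝ)).2 h1a
      have e2 := (Int.cast_le (R := ℝ)).2 h1b
      have e3 := (Int.cast_le (R := ℝ)).2 h2a
      have e4 := (Int.cast_le (R := ℝ)).2 h2b
      push_cast at e1 e2 e3 e4
      constructor <;> linarith
    have htail := sum_sum_mul_le B (fun p q => deltaPol M (L ^ k) p q)
      (fun p q => deltaZ L k ((p.1 : Fin (d + 1) → ℤ), p.2) ((q.1 : Fin (d + 1) → ℤ), q.2))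
      (E := tailConst d * Real.exp (kappaZ d * (2 * (A : ℝ))) * Real.exp (-(kappaZ d * (((N * L : ℕ) : ℝ) - 1))))
      (fun p q hp hq => by
        refine (deltaPol_sub_deltaZ_abs_le L k M hNL1 hMNL p q).trans ?_
        have h1 : Real.exp (kappaZ d * dist (p.1 : Fin (d + 1) → ℤ) (q.1 : Fin (d + 1) → ℤ)) ≤
            Real.exp (kappaZ d * (2 * (A : ℝ))) :=
          Real.exp_le_exp.2 (mul_le_mul_of_nonneg_left (hdist p q hp hq) hκ.le)
        have h0 : 0 ≤ tailConst d := by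
          unfold tailConst DirichletExhaustionDeltaZ.c166Z
          have := B5Symbol166Strip.MG_pos (d + 1)
          have := B4Sect5Proof.latticeConst_nonneg (d + 1) (kappaZ_pos d).le
          positivity
        exact mul_le_mul_of_nonneg_right (mul_le_mul_of_nonneg_left h1 h0) (Real.exp_pos _).le)
    have habs : ∑ b : B4.Idx (pbox M) (d + 1), |B b| = ∑ r ∈ R, |w r| := by
      simp only [hB]
      exact sum_box_translate t R (fun r => |w r|) (fun r hr => by simp only [hsupp r hr, abs_zero]) hbox
    rw [hmain, habs] at htail
    have hE : tailConst d * Real.exp (kappaZ d * (2 * (A : ℝ))) * Real.exp (-(kappaZ d * (((N * L : ℕ) : ℝ) - 1))) *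
        (∑ r ∈ R, |w r|) ^ 2 = Cst * Real.exp (-(kappaZ d * (((N * L : ℕ) : ℝ) - 1))) := by
      rw [hCst]; ring
    rw [hE] at htail
    exact hlow.trans htail
  -- `N → ∞`
  refine le_of_forall_pos_lt_add fun ε hε => ?_
  obtain ⟨N₁, hN₁⟩ := exists_nat_gt (Cst / ε / kappaZ d + 1)
  have hkey := key (max (2 * A + 3) N₁) (le_max_left _ _)
  set x : ℝ := kappaZ d * ((((max (2 * A + 3) N₁) * L : ℕ) : ℝ) - 1) with hx
  have hNx : Cst / ε < x + 1 := by
    have h1 : (N₁ : ℝ) ≤ ((max (2 * A + 3) N₁ : ℕ) : ℝ) := by exact_mod_cast le_max_right _ _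
    have h2 : (((max (2 * A + 3) N₁) : ℕ) : ℝ) ≤ ((((max (2 * A + 3) N₁) * L : ℕ) : ℝ)) := by
      have : max (2 * A + 3) N₁ ≤ max (2 * A + 3) N₁ * L := Nat.le_mul_of_pos_right _ hL
      exact_mod_cast this
    have h3 : Cst / ε / kappaZ d < ((((max (2 * A + 3) N₁) * L : ℕ) : ℝ)) - 1 := by linarith
    have h4 := (div_lt_iff₀ hκ).1 h3
    rw [hx]; linarith
  have hx0 : 0 ≤ x := by
    rw [hx]
    have : (1 : ℝ) ≤ ((((max (2 * A + 3) N₁) * L : ℕ) : ℝ)) := by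
      have : 1 ≤ max (2 * A + 3) N₁ * L := Nat.mul_pos (by omega) hL
      exact_mod_cast this
    exact mul_nonneg hκ.le (by linarith)
  have hexp : Real.exp (-x) ≤ 1 / (x + 1) := by
    rw [Real.exp_neg, one_div]
    exact inv_anti₀ (by linarith) (by linarith [Real.add_one_le_exp x])
  have htail : Cst * Real.exp (-x) < ε := by
    calc Cst * Real.exp (-x) ≤ Cst * (1 / (x + 1)) := mul_le_mul_of_nonneg_left hexp hCst0
      _ = Cst / (x + 1) := by ring
      _ < ε := by
          rw [div_lt_iff₀ (by linarith)]
          calc Cst = ε * (Cst / ε) := by field_simp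
            _ < ε * (x + 1) := mul_lt_mul_of_pos_left hNx hε
  linarith

end

end Summit.QuantumFields.BalabanUV.Beta.GAN24.DirichletExhaustionCoerZ
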